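import Literature.AlgebraicGeometry.AbelianSchemes.DualPairDimEq
import Literature.AlgebraicGeometry.Dimension.SmoothRelativeDimensionLocus
import HarnessLib

/-!
# The dual abelian scheme has the same relative dimension: `Â → S` is of relative dimension `g` whenever `A → S` is
# ([Mumford AV] §13 Cor. 3 in families; [MFK94] Cor. 6.8)

Topic `Literature/AlgebraicGeometry/AbelianSchemes`; namespace `Literature.AlgebraicGeometry.AbelianSchemes.AbelianSchemeOver.DualPair`.  THEOREMS ONLY (no
definition, no named fact, no instance, no notation, no `sorry`).  Cell `hodgecm-mathlib` (D-0151), FLOOR 0, P6 «MOD programme» (crux hLiu418 =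
stmt-HodgeConjecture-24832), organ **(s2-rd) «REL-DIM OF THE DUAL, NO LETTER»** (LEAD F0P6-plan (g3) deal (9), 2026-09-01): for the tree՚s INTERFACE dual pair ★
`AbelianSchemeDualPair` (`Â` pinned by the universal property only), the relative dimension of `Â → S` was available only on a CONNECTED base from ONE
witness point (★ (W-hdim) `DualPairFibreDimOfConnectedStage`) or by transport between two dual pairs (★ `DualPairHatRelDimTransport`).  With ★ (σ1-g)
`DualPair.dim_hat_eq` («`dim Â = dim A` over any field», p847199) every fibre is a witness, so the equality of relative dimensions holds over ANY base:
it discharges the binders `hÂ : Dₜ.hat.IsOfRelDim g` of ★ `PolarizationSpreadOfGenericPolarization` ED. 2 and the second `relDim` row of the RGD spine for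
EVERY dual pair, and makes clause (ii) of the P-2′ «DUAL-S» letter non-load-bearing.  HC_CM is proved only modulo the printed citations until rung 0 closes;
nothing here is about HC.

* `dim_hat_fibre_eq_of_isOfRelDim'` — `dim Â_s = g` at every field-valued point `s` (★ `dim_hat_eq` at the fibre, for the base-changed dual pair ★
  `DualPair.baseChange`; `(D.baseChange s).hat = Â ×_S Spec Ω` and `(A.fibre s).toOver = A ×_S Spec Ω` are definitional);
* **`hat_isOfRelDim (D : A.DualPair) (hA : A.IsOfRelDim g) : D.hat.IsOfRelDim g`** — the fibre criterion for the relative dimension of the smooth `Â → S`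
  (★ `Dimension/SmoothRelativeDimensionLocus`: the largest open of relative dimension `g` contains every point lying over a residue-field point whose fibre is
  smooth of relative dimension `g`, ★ `AbelianScheme.isOfRelDim_dim`);
* (the pointwise `dim A_s = dim Â_s` for every field point, with no hypothesis at all, is ★ B-p02 `DualPairFibreDimEq.dim_fibre_eq_dim_hat_fibre`, landed
  in parallel — not restated here).

## References
* [MumfordAV1970] D. Mumford, *Abelian Varieties* (1970), §13 Cor. 3 (p. 130).
* [MumfordFogartyKirwan1994] D. Mumford, J. Fogarty, F. Kirwan, *GIT*, 3rd ed. (1994), Ch. 6 §1 Cor. 6.8 (p. 118).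
* [GortzWedhorn2020] U. Görtz, T. Wedhorn, *Algebraic Geometry I*, 2nd ed. (2020), Prop. 6.15 (1), Lemma 6.26, Remark 16.54 (p. 539).
-/

set_option autoImplicit false

noncomputable section

-- `Over`/`Scheme` wrappers are not reducible (as in ★ `AbelianSchemes/*`).
set_option backward.isDefEq.respectTransparency false

universe u

open CategoryTheory CategoryTheory.Limits AlgebraicGeometry TopologicalSpace

namespace Literature.AlgebraicGeometry.AbelianSchemes.AbelianSchemeOver.DualPair

open Literature.AlgebraicGeometry.Motives Literature.AlgebraicGeometry.Dimension

variable {S : Scheme.{u}} {A : AbelianSchemeOver S} (D : A.DualPair) {g : ℕ}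

/-- **The fibres of `Â` have dimension `g` when `A → S` has relative dimension `g`** — at EVERY field-valued point `s : Spec Ω → S`: the fibre
`Â_s` is the dual of `A_s` for the base-changed dual pair `D_s` (★ `DualPair.baseChange`, `baseChange_hat`, `toOver_fibre` — definitional), so
`dim Â_s = dim A_s` by ★ (σ1-g) `DualPair.dim_hat_eq` over the field `Ω`, and `dim A_s = g` (★ `dim_fibre_of_isOfRelDim`).
[cite: MumfordAV1970, §13 Cor. 3 (p. 130)] [cite: GortzWedhorn2020, Remark 16.54 (p. 539)] -/
theorem dim_hat_fibre_eq_of_isOfRelDim' (hA : A.IsOfRelDim g) {Ω : Type u} [Field Ω] (s : Spec (.of Ω) ⟶ S) :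
    (D.hat.fibre s).toAbelianVariety.dim = g := by
  have h := DualPair.dim_hat_eq (A.fibre s).toAbelianVariety
    (D.baseChange s : (AbelianScheme.ofAbelianVariety (A.fibre s).toAbelianVariety).toOver.DualPair)
  rw [dim_fibre_of_isOfRelDim hA s] at h
  exact h

/-- **`Â → S` IS OF RELATIVE DIMENSION `g` WHEN `A → S` IS** ([MumfordAV1970] §13 Cor. 3 «`dim X̂ = dim X`» in families; [MumfordFogartyKirwan1994] Cor. 6.8:
`X̂` is an abelian scheme of the same relative dimension) — for the tree՚s INTERFACE dual pair ★ `AbelianSchemeDualPair`, over ANY base, with no unit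
hypothesis and no polarisation.  By the FIBRE CRITERION for the relative dimension of the smooth `Â → S` (★ `exists_opens_smoothOfRelativeDimension_maximal`,
★ `mem_of_smoothOfRelativeDimension_pullback_snd`): every point lies over a residue-field point `s` (Mathlib `Scheme.fromSpecResidueField`), and the fibre
`Â_s → Spec κ(s)` is smooth of relative dimension `dim Â_s = g` (`dim_hat_fibre_eq_of_isOfRelDim'`, ★ `AbelianScheme.isOfRelDim_dim`); so the largest open
of relative dimension `g` is all of `Â` (★ `IsZariskiLocalAtSource.iff_of_iSup_eq_top`).  Discharges the `hÂ : D.hat.IsOfRelDim g` ∕ `relDim` binders of the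
P6 consumers (★ `PolarizationSpreadOfGenericPolarization` ED. 2, the RGD spine) for every dual pair.
[cite: MumfordAV1970, §13 Cor. 3 (p. 130)] [cite: MumfordFogartyKirwan1994, Ch. 6 §1 Cor. 6.8 (p. 118)] [cite: GortzWedhorn2020, Prop. 6.15 (1) and Lemma 6.26] -/
theorem hat_isOfRelDim (hA : A.IsOfRelDim g) : D.hat.IsOfRelDim g := by
  haveI : Smooth D.hat.X.hom := D.hat.isSmooth
  obtain ⟨U, hU, hmax⟩ := exists_opens_smoothOfRelativeDimension_maximal D.hat.X.hom g
  have hxU : ∀ x : D.hat.X.left, x ∈ U := fun x => by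
    -- the residue-field point under `x` and the fibre of `Â` there
    have hs : SmoothOfRelativeDimension g (pullback.snd D.hat.X.hom (S.fromSpecResidueField (D.hat.X.hom x))) := by
      have h := (D.hat.fibre (S.fromSpecResidueField (D.hat.X.hom x))).isOfRelDim_dim
      rw [D.dim_hat_fibre_eq_of_isOfRelDim' hA (S.fromSpecResidueField (D.hat.X.hom x))] at h
      exact h
    haveI := hs
    exact mem_of_smoothOfRelativeDimension_pullback_snd D.hat.X.hom hmax (S.fromSpecResidueField (D.hat.X.hom x))
      (by rw [Scheme.range_fromSpecResidueField]; exact Set.mem_singleton _)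
  have htop : ⨆ _ : Unit, U = ⊤ := top_le_iff.mp fun x _ => Opens.mem_iSup.mpr ⟨(), hxU x⟩
  have h := (IsZariskiLocalAtSource.iff_of_iSup_eq_top (P := @SmoothOfRelativeDimension g) (fun _ : Unit => U) htop
    (f := D.hat.X.hom)).mpr fun _ => hU
  exact h

end Literature.AlgebraicGeometry.AbelianSchemes.AbelianSchemeOver.DualPair

end
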